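import Summits.CriticalPhenomena.PercolationContinuityZ3.Theorems.PercNearOneGluingNoHeavyLowerTailKnQuestion8CoefficientwiseCoreClassDomLeaf
import HarnessLib

/-!
# THEOREM LEAF: CW-PA on the core class over a middle graph with a new terminal leaf

Support file (`--supports stmt-CriticalPhenomena-4575`, closed), prover `prim-cplus-coupling` (gen 30).  No definitions, no notations, no named facts,
no sorries; standard axioms.  Memo `prim-cplus-coupling/A5-COUPLING-gen30.md` §3.3.  The kernel is `…CoreClassDomLeaf` (`coreClass_kernel_nonneg_leaf`);
this file is the peeling wrapper (same bookkeeping as `cwpa_coreClass_of_dom`).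
* `Coefficientwise.cwpa_coreClass_of_leaf` — core class `N(x) = N(z) = {a′, b}` whose middle graph is `insert e E_H` with `ends e = s(a′, a)`, `a′` on no
  edge of `E_H` (a terminal leaf hung at the vertex `a` of `H`): if `(E_H; a, b)` has a PROPER domination map (e.g. the involution `R_A` of a pocket-free
  `(H; a, b)` — all thread bundles, all `H` with `a` joined to every vertex but `b` — or a parallel product of proper maps), then CW-PA holds for all monotone
  `f, g`.  New infinite families: leaf + bundle `a′–a–Θ(k₁,…,k_r)–b` (where NO domination map of the enlarged middle graph need exist).
[cite: KozmaNitzan2024, Questions 8–9 (§5.5 p. 36) (context: the Question-8 pocket covariance programme)]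
-/

namespace Summit.CriticalPhenomena.PercolationContinuityZ3.Theorems

open Finset Literature.Probability.Percolation

namespace Coefficientwise

variable {ι V : Type*}

open Classical in
/-- **THEOREM LEAF — CW-PA for the core class `N(x) = N(z) = {a′, b}` over `insert e E_H` (a terminal leaf `e = a′a` hung at `a`).**
Hypotheses: the core-class bookkeeping for the middle graph `insert e E_H` with `x, z` joined to `a′` and `b`; `e ∉ E_H`, `ends e = s(a′,a)`, `a′` on no edge of
`E_H`, `a′ ≠ a, b`; and a proper domination map `ψ` of `(E_H; a, b)`.  Conclusion: for all monotone `f, g`,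
`0 ≤ Σ_{s ⊆ E₀ : z ∉ C_x(s), z ∉ C_x(E₀∖s)} f(C_x s)·(g(C_x s) − g(C_x(E₀∖s)))`. [cite: KozmaNitzan2024, Questions 8–9 (§5.5 p. 36) (context)] -/
theorem cwpa_coreClass_of_leaf (ends : ι → Sym2 V) (EH E₀ : Finset ι) (x z a a' b : V) (e ixa ixb iza izb : ι)
    (he : e ∉ EH) (hends : ends e = s(a', a)) (ha'E : ∀ i ∈ EH, a' ∉ ends i) (ha'a : a' ≠ a) (ha'b : a' ≠ b)
    (hxa : ends ixa = s(x, a')) (hxb : ends ixb = s(x, b)) (hza : ends iza = s(z, a')) (hzb : ends izb = s(z, b))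
    (hH : ∀ i ∈ insert e EH, x ∉ ends i ∧ z ∉ ends i) (hE₀ : ∀ i, i ∈ E₀ ↔ i ∈ insert e EH ∨ i = ixa ∨ i = ixb ∨ i = iza ∨ i = izb)
    (hnot : ixa ∉ insert e EH ∧ ixb ∉ insert e EH ∧ iza ∉ insert e EH ∧ izb ∉ insert e EH)
    (hd : ixa ≠ ixb ∧ ixa ≠ iza ∧ ixa ≠ izb ∧ ixb ≠ iza ∧ ixb ≠ izb ∧ iza ≠ izb)
    (hxz : x ≠ z) (hxa' : x ≠ a') (hxb' : x ≠ b) (hza' : z ≠ a') (hzb' : z ≠ b)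
    (ψ : Finset ι → Finset ι)
    (hψE : ∀ ω, ω ⊆ EH → b ∉ openCluster (ends '' (↑ω : Set ι)) a → b ∉ openCluster (ends '' (↑(EH \ ω) : Set ι)) a → ψ ω ⊆ EH)
    (hψcov : ∀ ω, ω ⊆ EH → b ∉ openCluster (ends '' (↑ω : Set ι)) a → b ∉ openCluster (ends '' (↑(EH \ ω) : Set ι)) a →
      openCluster (ends '' (↑ω : Set ι)) a ∪ openCluster (ends '' (↑(EH \ ω) : Set ι)) b ⊆
        openCluster (ends '' (↑(ψ ω) : Set ι)) a ∪ openCluster (ends '' (↑(ψ ω) : Set ι)) b)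
    (hψinj : ∀ ω₁ ω₂, ω₁ ⊆ EH → b ∉ openCluster (ends '' (↑ω₁ : Set ι)) a → b ∉ openCluster (ends '' (↑(EH \ ω₁) : Set ι)) a →
      ω₂ ⊆ EH → b ∉ openCluster (ends '' (↑ω₂ : Set ι)) a → b ∉ openCluster (ends '' (↑(EH \ ω₂) : Set ι)) a → ψ ω₁ = ψ ω₂ → ω₁ = ω₂)
    (hψprop : ∀ ω, ω ⊆ EH → b ∉ openCluster (ends '' (↑ω : Set ι)) a → b ∉ openCluster (ends '' (↑(EH \ ω) : Set ι)) a →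
      b ∉ openCluster (ends '' (↑(ψ ω) : Set ι)) a)
    (f g : Set V → ℝ) (hf : Monotone f) (hg : Monotone g) :
    0 ≤ ∑ s ∈ E₀.powerset.filter (fun s : Finset ι => z ∉ openCluster (ends '' (↑s : Set ι)) x ∧ z ∉ openCluster (ends '' (↑(E₀ \ s) : Set ι)) x),
      f (openCluster (ends '' (↑s : Set ι)) x) * (g (openCluster (ends '' (↑s : Set ι)) x) - g (openCluster (ends '' (↑(E₀ \ s) : Set ι)) x)) := by
  set EH₁ : Finset ι := insert e EH with hEH₁
  set K : Finset ι → Set V := fun s => openCluster (ends '' (↑s : Set ι)) x with hK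
  set Tset := E₀.powerset.filter (fun s : Finset ι => z ∉ K s ∧ z ∉ K (E₀ \ s)) with hT
  change 0 ≤ ∑ s ∈ Tset, f (K s) * (g (K s) - g (K (E₀ \ s)))
  -- normalise `f` at `{x}`
  set c : ℝ := f {x} with hc
  obtain ⟨f', hf'⟩ : ∃ f' : Set V → ℝ, f' = fun S => f S - c := ⟨_, rfl⟩
  have hswap0 : ∑ s ∈ Tset, (g (K s) - g (K (E₀ \ s))) = 0 := by
    rw [Finset.sum_sub_distrib, sub_eq_zero]
    have h := sum_powerset_filter_sdiff E₀ (fun s : Finset ι => z ∉ K s ∧ z ∉ K (E₀ \ s))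
      (fun s hs => by rw [Finset.sdiff_sdiff_eq_self hs]; exact and_comm) (fun s => g (K s))
    rw [hT]
    exact h.symm
  have hnorm : ∑ s ∈ Tset, f (K s) * (g (K s) - g (K (E₀ \ s))) = ∑ s ∈ Tset, f' (K s) * (g (K s) - g (K (E₀ \ s))) := by
    have : ∑ s ∈ Tset, f (K s) * (g (K s) - g (K (E₀ \ s))) =
        ∑ s ∈ Tset, f' (K s) * (g (K s) - g (K (E₀ \ s))) + c * ∑ s ∈ Tset, (g (K s) - g (K (E₀ \ s))) := by
      rw [Finset.mul_sum, ← Finset.sum_add_distrib]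
      refine Finset.sum_congr rfl fun s _ => ?_
      simp only [hf']; ring
    rw [this, hswap0, mul_zero, add_zero]
  rw [hnorm]
  -- split by the colours of `xa`, `xb`
  set F : Finset ι → ℝ := fun s => f' (K s) * (g (K s) - g (K (E₀ \ s))) with hF
  have hsplit : ∀ s, F s = (if ixa ∈ s ∧ ixb ∈ s then F s else 0) + (if ixa ∈ s ∧ ixb ∉ s then F s else 0)
      + (if ixb ∈ s ∧ ixa ∉ s then F s else 0) + (if ixa ∉ s ∧ ixb ∉ s then F s else 0) := by
    intro s; by_cases h1 : ixa ∈ s <;> by_cases h2 : ixb ∈ s <;> simp [h1, h2]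
  have hparts : ∑ s ∈ Tset, F s =
      (∑ s ∈ Tset.filter (fun s => ixa ∈ s ∧ ixb ∈ s), F s) + (∑ s ∈ Tset.filter (fun s => ixa ∈ s ∧ ixb ∉ s), F s)
      + (∑ s ∈ Tset.filter (fun s => ixb ∈ s ∧ ixa ∉ s), F s) + (∑ s ∈ Tset.filter (fun s => ixa ∉ s ∧ ixb ∉ s), F s) := by
    have h0 : ∑ s ∈ Tset, F s = ∑ s ∈ Tset, ((if ixa ∈ s ∧ ixb ∈ s then F s else 0) + (if ixa ∈ s ∧ ixb ∉ s then F s else 0)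
        + (if ixb ∈ s ∧ ixa ∉ s then F s else 0) + (if ixa ∉ s ∧ ixb ∉ s then F s else 0)) :=
      Finset.sum_congr rfl (fun s _ => hsplit s)
    rw [h0, Finset.sum_add_distrib, Finset.sum_add_distrib, Finset.sum_add_distrib, ← Finset.sum_filter, ← Finset.sum_filter,
      ← Finset.sum_filter, ← Finset.sum_filter]
  change 0 ≤ ∑ s ∈ Tset, F s
  rw [hparts]
  -- the four index sets as filters of `E₀.powerset`
  have hsetEq : ∀ (p : Finset ι → Prop) [DecidablePred p],
      Tset.filter p = E₀.powerset.filter (fun s : Finset ι => (z ∉ K s ∧ z ∉ K (E₀ \ s)) ∧ p s) := by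
    intro p _; ext s; simp only [hT, Finset.mem_filter, and_assoc]
  -- part RR
  have hRR : ∑ s ∈ Tset.filter (fun s => ixa ∈ s ∧ ixb ∈ s), F s =
      ∑ ω ∈ EH₁.powerset, f' ({x} ∪ openCluster (ends '' (↑ω : Set ι)) a' ∪ openCluster (ends '' (↑ω : Set ι)) b) *
        (g ({x} ∪ openCluster (ends '' (↑ω : Set ι)) a' ∪ openCluster (ends '' (↑ω : Set ι)) b) - g {x}) := by
    have h := coreClass_sum_two ends EH₁ E₀ hxa hxb hza hzb hH hE₀ hnot hd hxz hxa' hxb' hza' hzb' (fun P Q => f' P * (g P - g Q))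
    beta_reduce at h
    rw [← h]
    exact Finset.sum_congr (hsetEq _) (fun s _ => rfl)
  -- part RB
  have hRB : ∑ s ∈ Tset.filter (fun s => ixa ∈ s ∧ ixb ∉ s), F s =
      ∑ ω ∈ EH₁.powerset.filter (fun ω : Finset ι => b ∉ openCluster (ends '' (↑ω : Set ι)) a' ∧ b ∉ openCluster (ends '' (↑(EH₁ \ ω) : Set ι)) a'),
        f' ({x} ∪ openCluster (ends '' (↑ω : Set ι)) a') * (g ({x} ∪ openCluster (ends '' (↑ω : Set ι)) a') - g ({x} ∪ openCluster (ends '' (↑(EH₁ \ ω) : Set ι)) b)) := by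
    have h := coreClass_sum_one ends EH₁ E₀ hxa hxb hza hzb hH hE₀ hnot hd hxz hxa' hxb' hza' hzb' (fun P Q => f' P * (g P - g Q))
    beta_reduce at h
    rw [← h]
    exact Finset.sum_congr (hsetEq _) (fun s _ => rfl)
  -- part BR: the same lemma with `a' ↔ b`
  have hBR : ∑ s ∈ Tset.filter (fun s => ixb ∈ s ∧ ixa ∉ s), F s =
      ∑ ω ∈ EH₁.powerset.filter (fun ω : Finset ι => b ∉ openCluster (ends '' (↑ω : Set ι)) a' ∧ b ∉ openCluster (ends '' (↑(EH₁ \ ω) : Set ι)) a'),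
        f' ({x} ∪ openCluster (ends '' (↑ω : Set ι)) b) * (g ({x} ∪ openCluster (ends '' (↑ω : Set ι)) b) - g ({x} ∪ openCluster (ends '' (↑(EH₁ \ ω) : Set ι)) a')) := by
    have hE₀' : ∀ i, i ∈ E₀ ↔ i ∈ EH₁ ∨ i = ixb ∨ i = ixa ∨ i = izb ∨ i = iza := fun i => by rw [hE₀ i]; tauto
    have h := coreClass_sum_one ends EH₁ E₀ (x := x) (z := z) (a := b) (b := a') hxb hxa hzb hza hH hE₀'
      ⟨hnot.2.1, hnot.1, hnot.2.2.2, hnot.2.2.1⟩ ⟨hd.1.symm, hd.2.2.2.2.1, hd.2.2.2.1, hd.2.2.1, hd.2.1, hd.2.2.2.2.2.symm⟩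
      hxz hxb' hxa' hzb' hza' (fun P Q => f' P * (g P - g Q))
    beta_reduce at h
    have hidx : EH₁.powerset.filter (fun ω : Finset ι => a' ∉ openCluster (ends '' (↑ω : Set ι)) b ∧ a' ∉ openCluster (ends '' (↑(EH₁ \ ω) : Set ι)) b) =
        EH₁.powerset.filter (fun ω : Finset ι => b ∉ openCluster (ends '' (↑ω : Set ι)) a' ∧ b ∉ openCluster (ends '' (↑(EH₁ \ ω) : Set ι)) a') := by
      ext ω; simp only [Finset.mem_filter, mem_openCluster_comm ends ω b a', mem_openCluster_comm ends (EH₁ \ ω) b a']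
    rw [← hidx, ← h]
    exact Finset.sum_congr (hsetEq _) (fun s _ => rfl)
  -- part BB vanishes
  have hBB : ∑ s ∈ Tset.filter (fun s => ixa ∉ s ∧ ixb ∉ s), F s = 0 := by
    refine Finset.sum_eq_zero fun s hs => ?_
    rw [Finset.mem_filter, hT, Finset.mem_filter, Finset.mem_powerset] at hs
    obtain ⟨⟨hsE, -⟩, h1, h2⟩ := hs
    have hKs : K s = {x} := by
      refine openCluster_eq_singleton_of_no_edge_at ends s (fun i hi => ?_)
      rcases (hE₀ i).mp (hsE hi) with h | rfl | rfl | rfl | rfl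
      · exact (hH i h).1
      · exact absurd hi h1
      · exact absurd hi h2
      · rw [hza, Sym2.mem_iff, not_or]; exact ⟨hxz, hxa'⟩
      · rw [hzb, Sym2.mem_iff, not_or]; exact ⟨hxz, hxb'⟩
    simp only [hF, hf', hKs, hc, sub_self, zero_mul]
  rw [hRR, hRB, hBR, hBB, add_zero]
  -- the kernel, from the domination map
  have hker := coreClass_kernel_nonneg_leaf ends EH e a a' b he hends ha'E ha'a ha'b (fun S => f ({x} ∪ S) - c) (fun S => g ({x} ∪ S))
    (fun P Q h => by linarith [hf (Set.union_subset_union_right {x} h)])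
    (by simp only [Set.union_empty, hc, sub_self])
    (fun P Q h => hg (Set.union_subset_union_right {x} h)) ψ hψE hψcov hψinj hψprop
  rw [← hEH₁] at hker
  simp only [Set.union_empty] at hker
  rw [Finset.sum_add_distrib] at hker
  simp only [hf', Set.union_assoc]
  linarith


end Coefficientwise

end Summit.CriticalPhenomena.PercolationContinuityZ3.Theorems
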